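import Mathlib
import HarnessLib
import Summits.HubbardSuperconductivity.HubbardSuperconductivity.Theorems.KLProgrammeC4aPreCausticLevelLine

/-!
# Route `KLProgramme` — crux C4a, S3 brick (B4) «(U1)-LAWS» part 5b: the PRE-CAUSTIC LEVEL LINE WITH THE SPLIT — uniform deformation, support truncation at
# `e ≍ D`, kernel data from envelopes: `|∫_{lo..hi} w·X·∂_uK(e, ē(e))| ≤ X₀·A_fl(D) + 64Wκ²(X₀·ρ/D + … ) ` in the `D`-currency the angle layer consumes

Cell `gate-hubbard-kl`, seat hubbard-kl-k3c3-p3 (g31; row «implicit-function / monotonicity route for μ(n)»).  Located brick for the (C)-closer lane / the (M4)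
assembly of the umklapp first-order ϑ-layer (stub (C) `stub_twoLeg_curvature` of `KLRegimeEngineV17F2`, stmt-HubbardSuperconductivity-20437), memo
HOME/hubbard-kl-k3c3-p3/U1-CAUSTIC-SUP.md §11 (the (N2) pre-side composition, carrier-free level line).

WHY.  `…C4aPreCausticLevelLine.abs_intervalIntegral_deformed_antidiagonal_le` prices the level line by `(b − a)²` with a deformation `|r e| ≤ η|e − e₀|`; for the actual
band the deformation is naturally `|ē(e) − (D − e)| ≤ ρ` UNIFORMLY on the line (rate defect × length, the defect itself controlled by the caustic distance, part 5a),
and the line must be TRUNCATED where the finer-line SPLIT kills the kernel (`∂_uK(e,u) = 0` for `u ≤ q_s·e`, rule (iv) of record): beyond `e = κD`,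
`κ = 1/(q_s + 1/2)`, the integrand vanishes because `ē(e) ≤ D − e/2` (rate window).  So the effective length is `≤ κD`, the kernel data on the line follow from the
ENVELOPES (`|∂_uK(e,u)| ≤ 1/max(e,|u|)² ≤ 4/D²` on the anti-diagonal, `|∂_u²K| ≤ 1/max(e,|u|)³ ≤ 64/D³` within `D/2` of it), and the only genuine kernel input left is
the ANTI-DIAGONAL FLATNESS NUMBER `A_fl(D) ≥ |∫_{lo..hi} w(e)·∂_uK(e, D − e) de|` (k3c3-p1's (M1) files).
* §1 **`abs_intervalIntegral_deformed_antidiagonal_le_unif`** — the level-line law with a UNIFORM deformation bound: `|r| ≤ ρ₀` (Lipschitz zone) and `|r| ≤ ρ` (size)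
  ⟹ `|∫_a^b w·X·Ku(e, D − e + r e)| ≤ X₀·A_fl + W·(X₀B₂ρ + X₁B₁(b − a))·(b − a)`.
* §2 **`abs_intervalIntegral_levelLine_split_le`** (HEADLINE): levels `0 < lo ≤ hi`, anti-diagonal level `D > 0`, split parameter `q_s ≥ 1/2` (`κ = 1/(q_s + 1/2) ≤ 1`);
  kernel `K e ∈ C²` with `|(K e)′u| ≤ 1/max(e,|u|)²`, `|(K e)″u| ≤ 1/max(e,|u|)³`, `(K e)′u = 0` for `u ≤ q_s·e`; flatness `|∫_{lo..hi} w·(K e)′(D − e)| ≤ A_fl`; weight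
  `|X| ≤ X₀`, `|X e − X lo| ≤ X₁(e − lo)`; profile `0 ≤ w ≤ W`; the line `ē` with `|ē(e) − (D − e)| ≤ e/2` (rate window) and `≤ ρ` for `e ≤ κD` ⟹
  `|∫_{lo..hi} w·X·(K e)′(ē e) de| ≤ X₀·A_fl + W·(X₀·(64/D³)·ρ + X₁·(4/D²)·(κD))·(κD)`.
Pure real analysis; nothing about the model; nothing asserts (C), K3 or superconductivity.
References: FST II CPAM 51 (1998) §3 [cite: FeldmanSalmhoferTrubowitz1998]; Salmhofer 1999 §4.5.3 [cite: Salmhofer1999].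
-/

noncomputable section

namespace Summit.HubbardSuperconductivity.HubbardSuperconductivity.Theorems.C4a

set_option linter.dupNamespace false -- summit = problem name (single-conjunct summit), D-0017

open Real Set MeasureTheory intervalIntegral
open scoped Interval

/-! ## §1 The level line with a uniform deformation bound -/

/-- **THE PRE-CAUSTIC LEVEL LINE, UNIFORM DEFORMATION.**  As `…C4aPreCausticLevelLine.abs_intervalIntegral_deformed_antidiagonal_le`, but the deformation is controlled
uniformly: `|r e| ≤ ρ₀` (the zone where `Ku e` is `B₂`-Lipschitz around the anti-diagonal) and `|r e| ≤ ρ` (its size); then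
`|∫_a^b w·X·Ku(e, D − e + r e)| ≤ X₀·A_fl + W·(X₀B₂ρ + X₁B₁(b − a))·(b − a)`. -/
theorem abs_intervalIntegral_deformed_antidiagonal_le_unif {Ku : ℝ → ℝ → ℝ} {w X r : ℝ → ℝ} {a b e₀ D W X₀ X₁ ρ ρ₀ B₁ B₂ Afl : ℝ}
    (hab : a ≤ b) (he₀ : e₀ ∈ Icc a b)
    (hfi : IntervalIntegrable (fun e => w e * X e * Ku e (D - e + r e)) volume a b)
    (hgi : IntervalIntegrable (fun e => w e * Ku e (D - e)) volume a b)
    (hw0 : ∀ e ∈ Icc a b, 0 ≤ w e) (hwW : ∀ e ∈ Icc a b, w e ≤ W)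
    (hX0 : ∀ e ∈ Icc a b, |X e| ≤ X₀) (hX1 : ∀ e ∈ Icc a b, |X e - X e₀| ≤ X₁ * |e - e₀|)
    (hX₁ : 0 ≤ X₁) (hr : ∀ e ∈ Icc a b, |r e| ≤ ρ) (hr₀ : ∀ e ∈ Icc a b, |r e| ≤ ρ₀)
    (hB₁ : ∀ e ∈ Icc a b, |Ku e (D - e)| ≤ B₁) (hB₂0 : 0 ≤ B₂)
    (hB₂ : ∀ e ∈ Icc a b, ∀ u : ℝ, |u - (D - e)| ≤ ρ₀ → |Ku e u - Ku e (D - e)| ≤ B₂ * |u - (D - e)|)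
    (hflat : |∫ e in a..b, w e * Ku e (D - e)| ≤ Afl) :
    |∫ e in a..b, w e * X e * Ku e (D - e + r e)| ≤ X₀ * Afl + W * (X₀ * B₂ * ρ + X₁ * B₁ * (b - a)) * (b - a) := by
  have hX00 : 0 ≤ X₀ := (abs_nonneg _).trans (hX0 e₀ he₀)
  have hW0 : 0 ≤ W := (hw0 e₀ he₀).trans (hwW e₀ he₀)
  have hB₁0 : 0 ≤ B₁ := (abs_nonneg _).trans (hB₁ e₀ he₀)
  have hpt : ∀ e ∈ Ι a b, ‖w e * X e * Ku e (D - e + r e) - X e₀ * (w e * Ku e (D - e))‖ ≤ W * (X₀ * B₂ * ρ + X₁ * B₁ * (b - a)) := by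
    intro e he
    rw [uIoc_of_le hab] at he
    have heI : e ∈ Icc a b := Ioc_subset_Icc_self he
    have hee₀ : |e - e₀| ≤ b - a := by
      rw [abs_le]; constructor <;> linarith [heI.1, heI.2, he₀.1, he₀.2]
    have hu : |D - e + r e - (D - e)| ≤ ρ₀ := by rw [show D - e + r e - (D - e) = r e by ring]; exact hr₀ e heI
    have hK2 := hB₂ e heI (D - e + r e) hu
    rw [show D - e + r e - (D - e) = r e by ring] at hK2
    have hsplit : w e * X e * Ku e (D - e + r e) - X e₀ * (w e * Ku e (D - e)) =
        w e * (X e * (Ku e (D - e + r e) - Ku e (D - e)) + (X e - X e₀) * Ku e (D - e)) := by ring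
    rw [hsplit, Real.norm_eq_abs, abs_mul, abs_of_nonneg (hw0 e heI)]
    have h1 : |X e * (Ku e (D - e + r e) - Ku e (D - e))| ≤ X₀ * (B₂ * ρ) := by
      rw [abs_mul]
      exact mul_le_mul (hX0 e heI) (hK2.trans (mul_le_mul_of_nonneg_left (hr e heI) hB₂0)) (abs_nonneg _) hX00
    have h2 : |(X e - X e₀) * Ku e (D - e)| ≤ X₁ * (b - a) * B₁ := by
      rw [abs_mul]
      have hX1' : |X e - X e₀| ≤ X₁ * (b - a) := (hX1 e heI).trans (mul_le_mul_of_nonneg_left hee₀ hX₁)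
      exact mul_le_mul hX1' (hB₁ e heI) (abs_nonneg _) ((abs_nonneg _).trans hX1')
    calc w e * |X e * (Ku e (D - e + r e) - Ku e (D - e)) + (X e - X e₀) * Ku e (D - e)|
        ≤ W * (X₀ * (B₂ * ρ) + X₁ * (b - a) * B₁) :=
          mul_le_mul (hwW e heI) ((abs_add_le _ _).trans (add_le_add h1 h2)) (abs_nonneg _) hW0
      _ = W * (X₀ * B₂ * ρ + X₁ * B₁ * (b - a)) := by ring
  have hdiff := intervalIntegral.norm_integral_le_of_norm_le_const hpt
  rw [intervalIntegral.integral_sub hfi (hgi.const_mul (X e₀)), intervalIntegral.integral_const_mul, Real.norm_eq_abs,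
    abs_of_nonneg (sub_nonneg.2 hab)] at hdiff
  have hmain : |∫ e in a..b, w e * X e * Ku e (D - e + r e)| ≤
      |X e₀ * ∫ e in a..b, w e * Ku e (D - e)| + W * (X₀ * B₂ * ρ + X₁ * B₁ * (b - a)) * (b - a) := by
    have h := abs_sub_abs_le_abs_sub (∫ e in a..b, w e * X e * Ku e (D - e + r e)) (X e₀ * ∫ e in a..b, w e * Ku e (D - e))
    linarith
  refine hmain.trans ?_
  rw [abs_mul]
  have h3 : |X e₀| * |∫ e in a..b, w e * Ku e (D - e)| ≤ X₀ * Afl := mul_le_mul (hX0 e₀ he₀) hflat (abs_nonneg _) hX00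
  linarith

/-! ## §2 The level line with the split: truncation at `e = κD`, kernel data from the envelopes -/

/-- **THE PRE-CAUSTIC LEVEL LINE WITH THE SPLIT** (HEADLINE; see the module docstring).  Levels `0 < lo ≤ hi`; anti-diagonal level `D > 0`; split parameter
`q_s ≥ 1/2`; kernel `K e ∈ C²` with the two envelopes and the split support; flatness number `A_fl` at `D`; weight `X` (`|X| ≤ X₀`, `|X e − X lo| ≤ X₁(e − lo)`);
profile `0 ≤ w ≤ W`; the partner line `ē` with `|ē e − (D − e)| ≤ e/2` on `[lo,hi]` and `≤ ρ` for `e ≤ D/(q_s + 1/2)`; the two integrands interval-integrable.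
THEN `|∫_{lo..hi} w·X·(K e)′(ē e)| ≤ X₀·A_fl + W·(X₀·(64/D³)·ρ + X₁·(4/D²)·(D/(q_s + 1/2)))·(D/(q_s + 1/2))`. -/
theorem abs_intervalIntegral_levelLine_split_le {K : ℝ → ℝ → ℝ} {w X eb : ℝ → ℝ} {lo hi D qs X₀ X₁ W Afl ρ : ℝ}
    (hlo : 0 < lo) (hlohi : lo ≤ hi) (hD : 0 < D) (hqs : 1 / 2 ≤ qs) (hX₁ : 0 ≤ X₁) (hρ : 0 ≤ ρ)
    (hK : ∀ e ∈ Icc lo hi, ContDiff ℝ 2 (K e)) (hK1 : ∀ e ∈ Icc lo hi, ∀ u, |deriv (K e) u| ≤ (max e |u|)⁻¹ ^ 2)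
    (hK2 : ∀ e ∈ Icc lo hi, ∀ u, |iteratedDeriv 2 (K e) u| ≤ (max e |u|)⁻¹ ^ 3)
    (hsupp : ∀ e ∈ Icc lo hi, ∀ u, u ≤ qs * e → deriv (K e) u = 0)
    (hflat : |∫ e in lo..hi, w e * deriv (K e) (D - e)| ≤ Afl)
    (hfi : IntervalIntegrable (fun e => w e * X e * deriv (K e) (eb e)) volume lo hi)
    (hgi : IntervalIntegrable (fun e => w e * deriv (K e) (D - e)) volume lo hi)
    (hw0 : ∀ e ∈ Icc lo hi, 0 ≤ w e) (hwW : ∀ e ∈ Icc lo hi, w e ≤ W)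
    (hX0 : ∀ e ∈ Icc lo hi, |X e| ≤ X₀) (hXL : ∀ e ∈ Icc lo hi, |X e - X lo| ≤ X₁ * |e - lo|)
    (hdev : ∀ e ∈ Icc lo hi, |eb e - (D - e)| ≤ e / 2) (hdevρ : ∀ e ∈ Icc lo hi, e ≤ D / (qs + 1 / 2) → |eb e - (D - e)| ≤ ρ) :
    |∫ e in lo..hi, w e * X e * deriv (K e) (eb e)| ≤ X₀ * Afl + W * (X₀ * (64 / D ^ 3) * ρ + X₁ * (4 / D ^ 2) * (D / (qs + 1 / 2))) * (D / (qs + 1 / 2)) := by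
  have hloI : lo ∈ Icc lo hi := left_mem_Icc.2 hlohi
  have hX00 : 0 ≤ X₀ := (abs_nonneg _).trans (hX0 lo hloI)
  have hW0 : 0 ≤ W := (hw0 lo hloI).trans (hwW lo hloI)
  have hqs0 : 0 < qs + 1 / 2 := by linarith
  set κD : ℝ := D / (qs + 1 / 2) with hκD
  have hκD0 : 0 < κD := div_pos hD hqs0
  have hκDle : κD ≤ D := by rw [hκD, div_le_iff₀ hqs0]; nlinarith
  -- beyond `κD` both integrands vanish
  have hvan : ∀ e ∈ Icc lo hi, κD ≤ e → deriv (K e) (eb e) = 0 := fun e he hκe => by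
    refine hsupp e he _ ?_
    have h1 := (abs_le.1 (hdev e he)).2
    have h2 : D ≤ (qs + 1 / 2) * e := by rwa [hκD, div_le_iff₀ hqs0, mul_comm] at hκe
    linarith
  have hvan' : ∀ e ∈ Icc lo hi, κD ≤ e → deriv (K e) (D - e) = 0 := fun e he hκe => by
    refine hsupp e he _ ?_
    have h2 : D ≤ (qs + 1 / 2) * e := by rwa [hκD, div_le_iff₀ hqs0, mul_comm] at hκe
    have he0 : 0 ≤ e := hlo.le.trans he.1
    nlinarith
  have hAfl0 : 0 ≤ Afl := (abs_nonneg _).trans hflat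
  have hRHS0 : 0 ≤ X₀ * Afl + W * (X₀ * (64 / D ^ 3) * ρ + X₁ * (4 / D ^ 2) * κD) * κD := by positivity
  -- trivial case: the whole line lies beyond the split (`κD < lo`)
  rcases lt_or_ge κD lo with hsmall | hbig
  · have hzero : ∫ e in lo..hi, w e * X e * deriv (K e) (eb e) = 0 := by
      rw [← intervalIntegral.integral_zero (a := lo) (b := hi)]
      refine intervalIntegral.integral_congr fun e he => ?_
      rw [uIcc_of_le hlohi] at he
      simp only [hvan e he (hsmall.le.trans he.1), mul_zero]
    rw [hzero, abs_zero]; exact hRHS0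
  -- the truncation point `b = min hi κD ∈ [lo, hi]`
  set b : ℝ := min hi κD with hb
  have hlob : lo ≤ b := le_min hlohi hbig
  have hbhi : b ≤ hi := min_le_left _ _
  have hbκ : b ≤ κD := min_le_right _ _
  have hbsub : Icc lo b ⊆ Icc lo hi := Icc_subset_Icc le_rfl hbhi
  have hblen : b - lo ≤ κD := by linarith
  -- split the two integrals at `b`; the tails vanish
  have htail : ∫ e in b..hi, w e * X e * deriv (K e) (eb e) = 0 := by
    rcases le_total κD hi with h | h
    · have hbeq : b = κD := by rw [hb, min_eq_right h]
      rw [← intervalIntegral.integral_zero (a := b) (b := hi)]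
      refine intervalIntegral.integral_congr fun e he => ?_
      rw [uIcc_of_le hbhi] at he
      simp only [hvan e ⟨hlob.trans he.1, he.2⟩ (hbeq ▸ he.1), mul_zero]
    · have hbeq : b = hi := by rw [hb, min_eq_left h]
      rw [hbeq, intervalIntegral.integral_same]
  have htail' : ∫ e in b..hi, w e * deriv (K e) (D - e) = 0 := by
    rcases le_total κD hi with h | h
    · have hbeq : b = κD := by rw [hb, min_eq_right h]
      rw [← intervalIntegral.integral_zero (a := b) (b := hi)]
      refine intervalIntegral.integral_congr fun e he => ?_
      rw [uIcc_of_le hbhi] at he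
      simp only [hvan' e ⟨hlob.trans he.1, he.2⟩ (hbeq ▸ he.1), mul_zero]
    · have hbeq : b = hi := by rw [hb, min_eq_left h]
      rw [hbeq, intervalIntegral.integral_same]
  have hfi' : IntervalIntegrable (fun e => w e * X e * deriv (K e) (eb e)) volume lo b :=
    hfi.mono_set (by rw [uIcc_of_le hlohi, uIcc_of_le hlob]; exact hbsub)
  have hgi' : IntervalIntegrable (fun e => w e * deriv (K e) (D - e)) volume lo b :=
    hgi.mono_set (by rw [uIcc_of_le hlohi, uIcc_of_le hlob]; exact hbsub)
  have hfi'' : IntervalIntegrable (fun e => w e * X e * deriv (K e) (eb e)) volume b hi :=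
    hfi.mono_set (by rw [uIcc_of_le hlohi, uIcc_of_le hbhi]; exact Icc_subset_Icc hlob le_rfl)
  have hgi'' : IntervalIntegrable (fun e => w e * deriv (K e) (D - e)) volume b hi :=
    hgi.mono_set (by rw [uIcc_of_le hlohi, uIcc_of_le hbhi]; exact Icc_subset_Icc hlob le_rfl)
  have hsplit1 : ∫ e in lo..hi, w e * X e * deriv (K e) (eb e) = ∫ e in lo..b, w e * X e * deriv (K e) (eb e) := by
    rw [← intervalIntegral.integral_add_adjacent_intervals hfi' hfi'', htail, add_zero]
  have hsplit2 : ∫ e in lo..hi, w e * deriv (K e) (D - e) = ∫ e in lo..b, w e * deriv (K e) (D - e) := by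
    rw [← intervalIntegral.integral_add_adjacent_intervals hgi' hgi'', htail', add_zero]
  rw [hsplit1]
  rw [hsplit2] at hflat
  -- kernel data on the truncated line from the envelopes
  have heD : ∀ e ∈ Icc lo b, e ≤ D := fun e he => (he.2.trans hbκ).trans hκDle
  have hB₁ : ∀ e ∈ Icc lo b, |deriv (K e) (D - e)| ≤ 4 / D ^ 2 := fun e he => by
    have he0 : 0 < e := hlo.trans_le he.1
    refine (hK1 e (hbsub he) (D - e)).trans ?_
    have hm : D / 2 ≤ max e |D - e| := by
      rcases le_total (D / 2) e with h | h
      · exact le_max_of_le_left h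
      · exact le_max_of_le_right (by rw [abs_of_nonneg (by linarith [heD e he])]; linarith)
    rw [inv_pow, show (4 : ℝ) / D ^ 2 = ((D / 2) ^ 2)⁻¹ by field_simp; norm_num]
    exact inv_anti₀ (by positivity) (pow_le_pow_left₀ (by positivity) hm 2)
  have hB₂ : ∀ e ∈ Icc lo b, ∀ u : ℝ, |u - (D - e)| ≤ D / 2 → |deriv (K e) u - deriv (K e) (D - e)| ≤ 64 / D ^ 3 * |u - (D - e)| := by
    intro e he u hu
    have he0 : 0 < e := hlo.trans_le he.1
    have hKe := hK e (hbsub he)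
    have hdiff : Differentiable ℝ (deriv (K e)) := by
      have h : Differentiable ℝ (iteratedDeriv 1 (K e)) := ContDiff.differentiable_iteratedDeriv 1 hKe (by norm_num)
      rwa [iteratedDeriv_one] at h
    have hd2 : ∀ x, deriv (deriv (K e)) x = iteratedDeriv 2 (K e) x := fun x => by
      rw [show iteratedDeriv 2 (K e) = deriv (iteratedDeriv 1 (K e)) from iteratedDeriv_succ, iteratedDeriv_one]
    -- on the segment the envelope floor is `D/4`
    have hseg : ∀ x ∈ uIcc (D - e) u, ‖deriv (deriv (K e)) x‖ ≤ 64 / D ^ 3 := fun x hx => by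
      rw [Real.norm_eq_abs, hd2]
      refine (hK2 e (hbsub he) x).trans ?_
      have hxd : |x - (D - e)| ≤ D / 2 := by
        have hu1 := (abs_le.1 hu).1
        have hu2 := (abs_le.1 hu).2
        rcases le_total (D - e) u with h | h
        · rw [uIcc_of_le h] at hx
          rw [abs_le]; constructor
          · linarith [hx.1]
          · linarith [hx.2]
        · rw [uIcc_of_ge h] at hx
          rw [abs_le]; constructor
          · linarith [hx.1]
          · linarith [hx.2]
      have hm : D / 4 ≤ max e |x| := by
        rcases le_total (D / 4) e with h | h
        · exact le_max_of_le_left h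
        · refine le_max_of_le_right ?_
          have : D / 4 ≤ x := by have := (abs_le.1 hxd).1; linarith [heD e he]
          exact this.trans (le_abs_self x)
      rw [inv_pow, show (64 : ℝ) / D ^ 3 = ((D / 4) ^ 3)⁻¹ by field_simp; norm_num]
      exact inv_anti₀ (by positivity) (pow_le_pow_left₀ (by positivity) hm 3)
    have hmvt := Convex.norm_image_sub_le_of_norm_deriv_le (fun x _ => hdiff.differentiableAt) hseg
      (convex_uIcc (D - e) u) left_mem_uIcc right_mem_uIcc
    rwa [Real.norm_eq_abs, Real.norm_eq_abs] at hmvt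
  -- the uniform level-line law on `[lo, b]`
  have hfi3 : IntervalIntegrable (fun e => w e * X e * deriv (K e) (D - e + (eb e - (D - e)))) volume lo b := by
    simpa only [show ∀ e, D - e + (eb e - (D - e)) = eb e from fun e => by ring] using hfi'
  have hmain := abs_intervalIntegral_deformed_antidiagonal_le_unif (Ku := fun e u => deriv (K e) u) (r := fun e => eb e - (D - e)) (ρ₀ := D / 2)
    hlob (left_mem_Icc.2 hlob) hfi3 hgi'
    (fun e he => hw0 e (hbsub he)) (fun e he => hwW e (hbsub he)) (fun e he => hX0 e (hbsub he)) (fun e he => hXL e (hbsub he)) hX₁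
    (fun e he => hdevρ e (hbsub he) (he.2.trans hbκ)) (fun e he => (hdev e (hbsub he)).trans (by linarith [heD e he]))
    hB₁ (by positivity) hB₂ hflat
  simp only [show ∀ e, D - e + (eb e - (D - e)) = eb e from fun e => by ring] at hmain
  refine hmain.trans ?_
  have hbl0 : 0 ≤ b - lo := sub_nonneg.2 hlob
  have hin : X₀ * (64 / D ^ 3) * ρ + X₁ * (4 / D ^ 2) * (b - lo) ≤ X₀ * (64 / D ^ 3) * ρ + X₁ * (4 / D ^ 2) * κD := by
    have := mul_le_mul_of_nonneg_left hblen (by positivity : 0 ≤ X₁ * (4 / D ^ 2)); linarith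
  have h0' : 0 ≤ X₀ * (64 / D ^ 3) * ρ + X₁ * (4 / D ^ 2) * κD := by positivity
  have hprod := mul_le_mul hin hblen hbl0 h0'
  have := mul_le_mul_of_nonneg_left hprod hW0
  linarith

end Summit.HubbardSuperconductivity.HubbardSuperconductivity.Theorems.C4a

end
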